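import Summits.AnomalousDissipation.AnomalousDissipation.Theorems.PumpedMirrorMirrorFloorTGExplicitEnergy
import Literature.Analysis.FluidPDE.InertialPairingStrainBounds

/-!
# `PumpedMirror.MirrorFloorTG` (stmt-AnomalousDissipation-15372): the ONE-SIDED plug-in (ad-p3 ROUND-7 §1(b) T1)

Helper file prepared by the cell's literature seat (ad-lit g12, candidate sha16 d57a57197b2bd285, referee g25 pre-read CLEAN)
and filed by a prover seat (ad-sawtooth-support g6) `--supports stmt-AnomalousDissipation-15372`.  Filed = the candidate's
first theorem VERBATIM; the candidate's two census-vocabulary corollaries (`uniformCertificateLevelTG_of_oneSided`,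
`floorAtLevelTG_of_oneSided`, stated over `UniformCertificateLevelTG` / `FloorAtLevelTG` of the crux workfile
`Cruxes/MirrorFloorTG/StrategistCensusR1.lean`) are NOT here because a Theorems file may not import a Cruxes workfile
(gate `lint.import`); they are 8-line `refine ⟨Φ, 0, ((f_TG,g) − ΛE)/2, ν₀, …⟩` wrappers of `floor_uniform_of_oneSidedStressBound`
and belong in the crux-side skeleton that registers those predicates.

The landed plug-in `floor_uniform_of_stressBound` (PumpedMirrorMirrorFloorTGExplicitEnergy §8) takes a TWO-SIDED
pointwise stress bound `|⟪∇w(x)v,v⟫| ≤ K|v|²`, whose reach is the signed Michell constant `E_abs`; its proof uses only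
the lower half `−K‖u‖² ≤ I_w(u)`.  Here the hypothesis is the ONE-SIDED cone bound `−Λ|v|² ≤ ⟪∇w(x)v,v⟫`
(`Def w ⪰ −Λ I`, reach `E_lin ≥ E_abs`; ELIN7: 0.0726 vs 0.0656 at degree 5), turned into `−Λ‖u‖² ≤ I_w(u)` on `L²` by
the Literature lemma `Torus.neg_mul_norm_sq_le_inertialPairing_of_pointwise` (InertialPairingStrainBounds, p486745),
with `0 ≤ Λ` DERIVED from `div w = 0` (`Torus.nonneg_of_neg_mul_le_inner_fderiv`) instead of assumed.  The rest of the
proof is the landed one verbatim.  In the census vocabulary this is a ν-UNIFORM certificate at level `E` with `θ₁ = 0`,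
`ε₀ = ((f_TG,w) − ΛE)/2` (p3's `OneSidedPlugInTG`).
-/

noncomputable section

set_option linter.dupNamespace false

namespace Summit.AnomalousDissipation.AnomalousDissipation.Theorems.PumpedMirrorMirrorFloorTG

open MeasureTheory Filter Topology UnitAddTorus
open scoped InnerProductSpace RealInnerProductSpace ENNReal NNReal
open Literature.Analysis.FunctionSpaces Literature.Analysis.FunctionSpaces.Torus Literature.Analysis.FluidPDE
open Summit.AnomalousDissipation.AnomalousDissipation.Theses.PumpedMirror
open Summit.AnomalousDissipation.AnomalousDissipation.Theorems.TaylorGreenLoudGalerkinStates.Negative (tgForce)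
open Summit.AnomalousDissipation.AnomalousDissipation.Theorems.TaylorCertificatesFloorCertificate
  (eigenforce_exists_workTest)

/-- **Uniform floor from a ONE-SIDED stress bound.** For a smooth, divergence-free, mean-zero `w` with
`−Λ|v|² ≤ ⟪∇w(x)v,v⟫` for all `x, v` (then `0 ≤ Λ` automatically) and a level `E` with `Λ·E < (f_TG, w)`, ONE cylindrical
test functional certifies `((f_TG,w) − Λ E)/2 ≤ ν‖∇u‖² + ⟨F_ν(u), Φ'(u)⟩` at every `u ∈ H` with `|u|² ≤ E`, for all
`0 < ν < ν₀`.  (One-sided twin of `floor_uniform_of_stressBound`; same proof with `hI` from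
`Torus.neg_mul_norm_sq_le_inertialPairing_of_pointwise`.) -/
theorem floor_uniform_of_oneSidedStressBound {w : UnitAddTorus (Fin 3) → EuclideanSpace ℝ (Fin 3)}
    (hw : Torus.IsSmooth w) (hdiv : Torus.IsDivFree w) (hmean : Torus.HasZeroMean w) {Λ : ℝ}
    (hΛ : ∀ (x : UnitAddTorus (Fin 3)) (v : EuclideanSpace ℝ (Fin 3)), -(Λ * ‖v‖ ^ 2) ≤ ⟪Torus.fderiv w x v, v⟫_ℝ)
    (E : ℝ) (hcE : Λ * E < ∫ x, ⟪tgForce x, w x⟫_ℝ) :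
    ∃ (Φ : Torus.CylindricalTest (Fin 3)) (ν₀ : ℝ), 0 < ν₀ ∧
      (∀ u : Torus.energySpace (Fin 3), ‖u‖ ^ 2 ≤ E → Φ.grad u = w) ∧
      ∀ ν : ℝ, 0 < ν → ν < ν₀ → ∀ u : Torus.energySpace (Fin 3), ‖u‖ ^ 2 ≤ E →
        ((∫ x, ⟪tgForce x, w x⟫_ℝ) - Λ * E) / 2 ≤
          ν * (Torus.eGradNormSq (u.1 : UnitAddTorus (Fin 3) → EuclideanSpace ℝ (Fin 3))).toReal +
            Torus.nsGeneratorPairing ν tgForce u (Φ.grad u) := by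
  have hw1 : Torus.IsContDiff 1 w := hw.isContDiff (by simp)
  have hΛ0 : 0 ≤ Λ := Torus.nonneg_of_neg_mul_le_inner_fderiv hw1 hdiv (x := 0) (hΛ 0)
  obtain ⟨Φ, hΦ⟩ := eigenforce_exists_workTest E hw hdiv hmean
  set M : ℝ := ‖((hw.laplacian).memLp 2).toLp (Torus.laplacian w)‖ with hM
  have hM0 : 0 ≤ M := norm_nonneg _
  set m : ℝ := (∫ x, ⟪tgForce x, w x⟫_ℝ) - Λ * E with hm
  have hm0 : 0 < m := by rw [hm]; linarith
  refine ⟨Φ, m / (2 * (Real.sqrt E * M + 1)), by positivity, hΦ, fun ν hν hνlt u hu => ?_⟩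
  rw [hΦ u hu, Torus.nsGeneratorPairing]
  have hD : 0 ≤ ν * (Torus.eGradNormSq (u.1 : UnitAddTorus (Fin 3) → EuclideanSpace ℝ (Fin 3))).toReal := by
    positivity
  have hI : -(Λ * E) ≤ Torus.inertialPairing u.1 w := by
    have h1 := Torus.neg_mul_norm_sq_le_inertialPairing_of_pointwise hw1 hΛ u.1
    rw [← Submodule.coe_norm] at h1
    nlinarith [mul_le_mul_of_nonneg_left hu hΛ0]
  have hV : |ν * ∫ x, ⟪((u.1 : Lp (EuclideanSpace ℝ (Fin 3)) 2 (volume : Measure (UnitAddTorus (Fin 3)))) :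
      UnitAddTorus (Fin 3) → EuclideanSpace ℝ (Fin 3)) x, Torus.laplacian w x⟫_ℝ| ≤ m / 2 := by
    have h1 : |Torus.pairing u.1 (Torus.laplacian w)| ≤ Real.sqrt E * M := by
      refine (Torus.abs_pairing_coe_le ((hw.laplacian).memLp 2) u).trans (mul_le_mul_of_nonneg_right ?_ hM0)
      rw [← Real.sqrt_sq (norm_nonneg u)]
      exact Real.sqrt_le_sqrt hu
    rw [abs_mul, abs_of_pos hν]
    have h2 : ν * (Real.sqrt E * M + 1) ≤ m / 2 := by
      have h3 : ν * (2 * (Real.sqrt E * M + 1)) ≤ m := by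
        rw [← le_div_iff₀ (by positivity)]; exact le_of_lt hνlt
      nlinarith
    calc ν * |∫ x, ⟪((u.1 : Lp (EuclideanSpace ℝ (Fin 3)) 2 (volume : Measure (UnitAddTorus (Fin 3)))) :
          UnitAddTorus (Fin 3) → EuclideanSpace ℝ (Fin 3)) x, Torus.laplacian w x⟫_ℝ|
        ≤ ν * (Real.sqrt E * M) := mul_le_mul_of_nonneg_left h1 hν.le
      _ ≤ ν * (Real.sqrt E * M + 1) := mul_le_mul_of_nonneg_left (by linarith) hν.le
      _ ≤ m / 2 := h2
  have hV' := neg_abs_le (ν * ∫ x, ⟪((u.1 : Lp (EuclideanSpace ℝ (Fin 3)) 2 (volume : Measure (UnitAddTorus (Fin 3)))) :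
      UnitAddTorus (Fin 3) → EuclideanSpace ℝ (Fin 3)) x, Torus.laplacian w x⟫_ℝ)
  linarith

end Summit.AnomalousDissipation.AnomalousDissipation.Theorems.PumpedMirrorMirrorFloorTG

end
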